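import Mathlib
import Summits.Ventures.HodgeRepro2.LiuOscillator
import Summits.Ventures.HodgeRepro2.T6B3Hyp
import Summits.Ventures.HodgeRepro2.T6B5Datum
import Summits.Ventures.HodgeRepro2.T6B5Hyp
import Summits.Ventures.HodgeRepro2.T6B5Main
import Summits.Ventures.HodgeRepro2.T6B5OrbitHyp

/-!
# T6B5Orbit — Tier 6, sub-goal B5: TIER4 Theorem B5.1(v) (orbit-invariance of the exponent) in kernel

TIER4 §B5 Step 6 [C] in kernel, over p2's accepted datum `S : Liu.AlbaneseH1Shape K c χEF` and B5's shape
`shape 𝓛 h411 K₀`: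
* `liuMultiplicity_eq_of_exhausting` — d(μ, L) is the same integer for every finite set exhausting the classes
  ω(μ, ε, χ) with non-zero `L`-invariants (no display: a kernel lemma about finite sums);
* `orbit_exponent` — from t6-p6's display of Cor. 4.20 and the displayed last sentence of Cor. 4.20
  (`Hyp.Liu2021_Cor4_20_orbit`), at every sufficiently small level the exponents of Cor. 4.20's decomposition are
  orbit-invariant, and every weight-one conjugate symplectic `μ` with `d(μ, L) ≥ 1` has its orbit represented in
  the product with the SAME exponent `d(μ', L) = d(μ, L)`;
* `B5_orbit` — Theorem B5.1(v) for the four triples of B3 at every small level where the four oscillator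
  representations have non-zero invariants (the levels of `B5_main`): every orbit-mate of `μ_i` has the same
  `d ≥ 1`, and the factor of Cor. 4.20's product indexed by the orbit of `μ_i` — computed at its representative —
  has exponent `d(μ'_i, L) = d(μ_i, L) ≥ 1` (the clause `B5_decomposition` leaves at `μ_i` itself).
Every published input is consumed BY NAME. README §8(d): uses an L-value-free non-vanishing device: NO.
-/

namespace Summit.Ventures.HodgeRepro2.T6.B5Orbit

open Summit.Ventures.HodgeRepro2.ShimuraData Summit.Ventures.HodgeRepro2.T6.B5Datum
  Summit.Ventures.HodgeRepro2.T6.B5Main Summit.Ventures.HodgeRepro2.T6.Hyp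

universe u

variable {K : Type u} [Field K] [NumberField K] [NumberField.IsCMField K] {c : Liu.IdeleConjugation K}
  {χEF : Liu.QuadraticCharacter K c}

/-- `T` EXHAUSTS the classes ω(μ, ε, χ) with non-zero `L`-invariants: its members are admissible triples with first
component `μ`, and every admissible triple with first component `μ` whose class has non-zero `L`-invariants has its
class in `T.image S.osc` — the two clauses of p2's `Liu.LiuCor420Shape` (t6-p6's display of Cor. 4.20), under which
`Liu.liuMultiplicity K S T L` is the printed integer d(μ, K). -/
def IsExhausting (S : Liu.AlbaneseH1Shape K c χEF) (μ : Liu.AutomorphicCharacter K)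
    (T : Finset (Liu.OscillatorTriple K c χEF)) (L : S.Level) : Prop :=
  (∀ t ∈ T, t.μ = μ ∧ Liu.OscillatorTriple.IsAdmissible K t) ∧
  (∀ t : Liu.OscillatorTriple K c χEF, Liu.OscillatorTriple.IsAdmissible K t → t.μ = μ →
    0 < S.dimInv (S.osc t) L → S.osc t ∈ T.image S.osc)

/-- The sum over `T.image S.osc` of the invariant dimensions equals the sum over `(T.image S.osc) ∩ (T'.image S.osc)`
when `T'` exhausts the classes with non-zero invariants: a class of `T` outside `T'.image S.osc` has zero
`L`-invariants. -/
theorem sum_eq_sum_inter (S : Liu.AlbaneseH1Shape K c χEF) {μ : Liu.AutomorphicCharacter K}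
    {T T' : Finset (Liu.OscillatorTriple K c χEF)} {L : S.Level} (hT : IsExhausting S μ T L)
    (hT' : IsExhausting S μ T' L) :
    ∑ π ∈ T.image S.osc, S.dimInv π L = ∑ π ∈ (T.image S.osc) ∩ (T'.image S.osc), S.dimInv π L := by
  symm
  apply Finset.sum_subset Finset.inter_subset_left
  intro π hπT hπ
  have hπT' : π ∉ T'.image S.osc := fun h => hπ (Finset.mem_inter.mpr ⟨hπT, h⟩)
  obtain ⟨t, htT, rfl⟩ := Finset.mem_image.mp hπT
  by_contra hne
  exact hπT' (hT'.2 t (hT.1 t htT).2 (hT.1 t htT).1 (Nat.pos_of_ne_zero hne))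

/-- d(μ, L) is well defined: any two finite sets exhausting the classes ω(μ, ε, χ) with non-zero `L`-invariants
give the same `Liu.liuMultiplicity` (the printed «integer d(μ, K)» does not depend on the exhausting set). -/
theorem liuMultiplicity_eq_of_exhausting (S : Liu.AlbaneseH1Shape K c χEF) {μ : Liu.AutomorphicCharacter K}
    {T T' : Finset (Liu.OscillatorTriple K c χEF)} {L : S.Level} (hT : IsExhausting S μ T L)
    (hT' : IsExhausting S μ T' L) : Liu.liuMultiplicity K S T L = Liu.liuMultiplicity K S T' L := by
  unfold Liu.liuMultiplicity
  rw [sum_eq_sum_inter S hT hT', sum_eq_sum_inter S hT' hT, Finset.inter_comm]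

/-- The exhausting sets of t6-p6's display of Cor. 4.20 (`Hyp.Liu2021_Cor4_20` = p2's `Liu.LiuCor420Shape`) at a
small level `L`, repackaged: representatives `reps`, exhausting sets `T μ` for EVERY `μ`, one representative per
orbit, every weight-one conjugate symplectic `μ` with `d(μ, L) > 0` represented, and the decomposition. -/
theorem cor420_exhausting (S : Liu.AlbaneseH1Shape K c χEF) (h420 : Liu2021_Cor4_20 S) (hn : 3 ≤ S.rank)
    (L : S.Level) (hL : S.IsSmall L) :
    ∃ (reps : Finset (Liu.AutomorphicCharacter K))
      (T : Liu.AutomorphicCharacter K → Finset (Liu.OscillatorTriple K c χEF)),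
      (∀ μ ∈ reps, Liu.IsWeightOneConjugateSymplectic K c χEF μ) ∧
      (∀ μ, IsExhausting S μ (T μ) L) ∧
      (∀ μ ∈ reps, ∀ μ' ∈ reps, S.galOrbit μ μ' → μ = μ') ∧
      (∀ μ, Liu.IsWeightOneConjugateSymplectic K c χEF μ → 0 < Liu.liuMultiplicity K S (T μ) L →
        ∃ μ' ∈ reps, S.galOrbit μ μ') ∧
      S.albanese L = ∏ μ ∈ reps, S.cmVariety μ ^ Liu.liuMultiplicity K S (T μ) L := by
  obtain ⟨reps, T, h1, h2, h3, h4, h5, h6⟩ := h420 hn L hL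
  exact ⟨reps, T, h1, fun μ => ⟨h2 μ, h3 μ⟩, h4, h5, h6⟩

/-- TIER4 Theorem B5.1(v), Step 6 [C], over the datum: from t6-p6's display of Cor. 4.20 and the displayed last
sentence of Cor. 4.20, at every sufficiently small level `L` (with `n ⩾ 3`) the decomposition
`A_L ∼ ∏_{μ ∈ reps} A_μ^{d(μ, L)}` of Cor. 4.20 has ORBIT-INVARIANT exponents — `d(μ, L) = d(μ', L)` for orbit-equivalent
weight-one conjugate symplectic `μ`, `μ'` — and every weight-one conjugate symplectic `μ` with `d(μ, L) ≥ 1` is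
represented in the product by a `μ' ∈ reps` of its orbit with the SAME exponent `d(μ', L) = d(μ, L)`. -/
theorem orbit_exponent (S : Liu.AlbaneseH1Shape K c χEF) (h420 : Liu2021_Cor4_20 S)
    (horb : Liu2021_Cor4_20_orbit S) (hn : 3 ≤ S.rank) (L : S.Level) (hL : S.IsSmall L) :
    ∃ (reps : Finset (Liu.AutomorphicCharacter K))
      (T : Liu.AutomorphicCharacter K → Finset (Liu.OscillatorTriple K c χEF)),
      (∀ μ ∈ reps, Liu.IsWeightOneConjugateSymplectic K c χEF μ) ∧
      (∀ μ, IsExhausting S μ (T μ) L) ∧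
      (∀ μ ∈ reps, ∀ μ' ∈ reps, S.galOrbit μ μ' → μ = μ') ∧
      S.albanese L = ∏ μ ∈ reps, S.cmVariety μ ^ Liu.liuMultiplicity K S (T μ) L ∧
      (∀ μ μ', Liu.IsWeightOneConjugateSymplectic K c χEF μ → Liu.IsWeightOneConjugateSymplectic K c χEF μ' →
        S.galOrbit μ μ' → Liu.liuMultiplicity K S (T μ) L = Liu.liuMultiplicity K S (T μ') L) ∧
      (∀ μ, Liu.IsWeightOneConjugateSymplectic K c χEF μ → 0 < Liu.liuMultiplicity K S (T μ) L →
        ∃ μ' ∈ reps, S.galOrbit μ μ' ∧ Liu.liuMultiplicity K S (T μ') L = Liu.liuMultiplicity K S (T μ) L) := by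
  obtain ⟨reps, T, h1, h2, h4, h5, h6⟩ := cor420_exhausting S h420 hn L hL
  have hinv : ∀ μ μ', Liu.IsWeightOneConjugateSymplectic K c χEF μ →
      Liu.IsWeightOneConjugateSymplectic K c χEF μ' → S.galOrbit μ μ' →
      Liu.liuMultiplicity K S (T μ) L = Liu.liuMultiplicity K S (T μ') L := fun μ μ' hμ hμ' hg =>
    horb L hL μ μ' hμ hμ' hg (T μ) (T μ') (h2 μ).1 (h2 μ).2 (h2 μ').1 (h2 μ').2
  refine ⟨reps, T, h1, h2, h4, h6, hinv, fun μ hμ hpos => ?_⟩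
  obtain ⟨μ', hμ'reps, hg⟩ := h5 μ hμ hpos
  exact ⟨μ', hμ'reps, hg, (hinv μ μ' hμ (h1 μ' hμ'reps) hg).symm⟩

variable (𝓛 : LiuAlbaneseDatum K c χEF)

/-- TIER4 Theorem B5.1(v) for the four triples of B3 at B5's shape: at every small level `L` where the four
oscillator representations have non-zero invariants (the levels of `B5_main`), every weight-one conjugate
symplectic orbit-mate `μ''` of `μ_i` has `d(μ'', L) = d(μ_i, L) ≥ 1`, and the factor of Cor. 4.20's product indexed
by the orbit of `μ_i` — computed at its representative `μ'_i ∈ reps` — has exponent `d(μ'_i, L) = d(μ_i, L) ≥ 1`.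
Inputs: the displayed Def. 4.11 (B5), t6-p6's display of Cor. 4.20 and the displayed last sentence of Cor. 4.20
at the shape, `n ⩾ 3`, the four admissible triples. -/
theorem B5_orbit (h411 : Liu2021_Def4_11 𝓛) (K₀ : OpenSubgroup 𝓛.G)
    (h420 : Liu2021_Cor4_20 (shape 𝓛 h411 K₀)) (horb : Liu2021_Cor4_20_orbit (shape 𝓛 h411 K₀))
    (hn : 3 ≤ 𝓛.n)
    (t : Fin 4 → Liu.OscillatorTriple K c χEF) (ht : ∀ i, Liu.OscillatorTriple.IsAdmissible K (t i))
    (L : CLevel 𝓛) (hL : (shape 𝓛 h411 K₀).IsSmall L)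
    (hpos : ∀ i, 0 < (shape 𝓛 h411 K₀).dimInv ((shape 𝓛 h411 K₀).osc (t i)) L) :
    ∃ (reps : Finset (Liu.AutomorphicCharacter K))
      (T : Liu.AutomorphicCharacter K → Finset (Liu.OscillatorTriple K c χEF)),
      (∀ μ ∈ reps, Liu.IsWeightOneConjugateSymplectic K c χEF μ) ∧
      (∀ μ, IsExhausting (shape 𝓛 h411 K₀) μ (T μ) L) ∧
      (∀ μ ∈ reps, ∀ μ' ∈ reps, (shape 𝓛 h411 K₀).galOrbit μ μ' → μ = μ') ∧
      (shape 𝓛 h411 K₀).albanese L =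
        ∏ μ ∈ reps, (shape 𝓛 h411 K₀).cmVariety μ ^ Liu.liuMultiplicity K (shape 𝓛 h411 K₀) (T μ) L ∧
      (∀ i, 0 < Liu.liuMultiplicity K (shape 𝓛 h411 K₀) (T (t i).μ) L) ∧
      (∀ i (μ'' : Liu.AutomorphicCharacter K), Liu.IsWeightOneConjugateSymplectic K c χEF μ'' →
        (shape 𝓛 h411 K₀).galOrbit (t i).μ μ'' →
        Liu.liuMultiplicity K (shape 𝓛 h411 K₀) (T μ'') L =
          Liu.liuMultiplicity K (shape 𝓛 h411 K₀) (T (t i).μ) L) ∧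
      (∀ i, ∃ μ' ∈ reps, (shape 𝓛 h411 K₀).galOrbit (t i).μ μ' ∧
        0 < Liu.liuMultiplicity K (shape 𝓛 h411 K₀) (T μ') L ∧
        Liu.liuMultiplicity K (shape 𝓛 h411 K₀) (T μ') L =
          Liu.liuMultiplicity K (shape 𝓛 h411 K₀) (T (t i).μ) L) := by
  obtain ⟨reps, T, h1, h2, h4, h6, hinv, hrep⟩ := orbit_exponent (shape 𝓛 h411 K₀) h420 horb hn L hL
  have hwo : ∀ i, Liu.IsWeightOneConjugateSymplectic K c χEF (t i).μ := fun i =>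
    Liu.OscillatorTriple.isWeightOneConjugateSymplectic K (ht i)
  have hposd : ∀ i, 0 < Liu.liuMultiplicity K (shape 𝓛 h411 K₀) (T (t i).μ) L := by
    intro i
    obtain ⟨t', ht'T, ht'⟩ := Finset.mem_image.mp ((h2 (t i).μ).2 (t i) (ht i) rfl (hpos i))
    have := Liu.dimInv_le_liuMultiplicity K (shape 𝓛 h411 K₀) ht'T L
    rw [ht'] at this
    exact lt_of_lt_of_le (hpos i) this
  refine ⟨reps, T, h1, h2, h4, h6, hposd, fun i μ'' hμ'' hg => (hinv (t i).μ μ'' (hwo i) hμ'' hg).symm,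
    fun i => ?_⟩
  obtain ⟨μ', hμ'reps, hg, heq⟩ := hrep (t i).μ (hwo i) (hposd i)
  exact ⟨μ', hμ'reps, hg, heq ▸ hposd i, heq⟩

end Summit.Ventures.HodgeRepro2.T6.B5Orbit
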